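import Literature.NumberTheory.NumberFields.QuadraticExtensionOddClassNumberNonNormUnit
import HarnessLib

/-!
# Odd class numbers go UP a totally real quadratic extension: ONE ramified prime and no unit condition, or at most THREE
# ramified primes and TWO independent non-norm units (Chevalley's ambiguous class number formula; genus theory)

Topic `NumberTheory/NumberFields`; namespace `Literature.NumberTheory.NumberFields.AmbiguousClass`. Theorem-only file
(no definition, no named fact, no instance, no `sorry`), written by the prover seat `bsd-2adic-k4-w3` GEN 15 (cell `bsd-2adic`;
`--supports` stmt-BirchSwinnertonDyer-22618: the parities of `h(A₁)`, `h(A₂)` for the cyclotomic layers `A₁ = E(√2)`,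
`A₂ = E(√(2+√2))` of a totally real cubic field `E` of discriminant `8m²` — there `A₁/E` is ramified at exactly ONE prime and
`A₂/A₁` at THREE primes, shapes the companion file `QuadraticExtensionOddClassNumberNonNormUnit.lean` (k4-w1 GEN 10: at most two
ramified primes and ONE non-norm unit) does not cover).  Closes nothing at the `∀`-level; BSD is not advanced by this file.

Chevalley (tree `ambiguousClassNumberFormula`, Lang, *Cyclotomic Fields I–II*, Ch. 13 §4 Lemma 4.1) for `L/K` quadratic, `L`
totally real: `#Cl(L)^G · 2 · [E_K : E_K ∩ N_{L/K} Lˣ] = h_K · ∏_𝔭 e_𝔭`.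

* `odd_classNumber_of_quadratic_of_isTotallyReal_of_prod_ramificationIdxIn_dvd_two` — `∏_𝔭 e_𝔭 ∣ 2` (at most one finite prime
  ramifies) and `h_K` odd ⟹ `h_L` odd, with NO unit hypothesis: `#Cl(L)^G · 2 · i = h_K · ∏ e_𝔭` and `∏ e_𝔭 · k = 2` give
  `#Cl(L)^G · i · k = h_K`.
* `four_dvd_relIndex_unitsNorm_of_not_mem` — two units `x, y ∈ E_K` with `x`, `y`, `xy` all outside `N_{L/K} Lˣ` make the unit index
  divisible by `4` (the classes of `1, x, y, xy` in `E_K/(E_K ∩ N)` are pairwise distinct).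
* `odd_classNumber_of_quadratic_of_isTotallyReal_of_not_mem_norm₂` — `∏_𝔭 e_𝔭 ∣ 8` (at most three finite primes ramify), `h_K` odd,
  and two such units ⟹ `h_L` odd: `#Cl(L)^G · 2 · 4m = h_K · ∏ e_𝔭`, `∏ e_𝔭 · k = 8`, so `#Cl(L)^G · m · k = h_K`.
* `odd_classNumber_of_quadratic_of_isTotallyReal_of_forall_sq_sub_mul_sq_ne₂` — the same with the units given in `𝓞 K` and the
  non-norm properties in norm-form currency `a² − m b² ≠ ε` (`L = K(s)`, `s² = m`, `s ∉ K`; O'Meara 63:10).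
* `norm_algebraMap_add_mul_eq` — the norm form itself: `N_{L/K}(a + b s) = a² − m b²` for `a, b ∈ K` (used downstream to compute
  the absolute norms of explicit dyadic prime elements of `L` through `N_{L/ℚ} = N_{K/ℚ} ∘ N_{L/K}`).

(Genus theory: `t` ramified places are exactly compensated by `t − 1` independent non-norm units.)
`-- TODO(general form): ∏ e_𝔭 ∣ 2^t with t − 1 independent non-norm unit classes (Gras, Class Field Theory, IV.4).`

## References

* S. Lang, *Cyclotomic Fields I and II*, GTM 121 (1990), Ch. 13 §4, Lemma 4.1 and 4.2 (PDF pp. 203–204). [Lang1990]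
* G. Gras, *Class Field Theory* (2003), IV.4 (genus theory: the number of invariant classes). [Gras2003]
* O. T. O'Meara, *Introduction to Quadratic Forms* (1963), §63B, 63:10 (norms from `K(√m)`). [Omeara1963]
-/

noncomputable section

open NumberField NumberField.InfinitePlace IsDedekindDomain
open scoped nonZeroDivisors

namespace Literature.NumberTheory.NumberFields.AmbiguousClass

open Literature.NumberTheory.GaloisRepresentations Literature.NumberTheory.GaloisRepresentations.Herbrand
  Literature.NumberTheory.GaloisRepresentations.MinkowskiUnit
  Literature.NumberTheory.GaloisRepresentations.CyclicNormIndex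

variable {K L : Type} [Field K] [NumberField K] [Field L] [NumberField L] [Algebra K L]

/-! ### One ramified prime: no unit condition -/

/-- **Odd class numbers go up a totally real quadratic extension with at most ONE ramified finite prime** (`[L : K] = 2`, Galois,
`L` totally real, `∏_𝔭 e_𝔭(L/K) ∣ 2`, `h_K` odd ⟹ `h_L` odd), with no hypothesis on units.  Chevalley: `#Cl(L)^G · 2 · i = h_K · ∏ e_𝔭 · 1`
with `∏ e_𝔭 · k = 2`, so `#Cl(L)^G · i · k = h_K` is odd, `#Cl(L)^G` is odd, and `odd_classNumber_of_odd_card_fixed` concludes.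
[cite: Lang1990, Ch. 13 §4, Lemma 4.1 (PDF pp. 203–204)] [cite: Gras2003, IV.4 (genus theory)] -/
theorem odd_classNumber_of_quadratic_of_isTotallyReal_of_prod_ramificationIdxIn_dvd_two [IsGalois K L] [IsTotallyReal L]
    (h2 : Module.finrank K L = 2) (hram : (∏ᶠ v : HeightOneSpectrum (𝓞 K), v.asIdeal.ramificationIdxIn (𝓞 L)) ∣ 2)
    (hK : Odd (classNumber K)) : Odd (classNumber L) := by
  classical
  obtain ⟨σ, -, -, hσ⟩ := exists_algEquiv_ne_one_of_finrank_eq_two (K := K) (L := L) h2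
  have hChev := ambiguousClassNumberFormula hσ
  rw [h2, archFactor_eq_one_of_isTotallyReal, mul_one] at hChev
  obtain ⟨k, hk⟩ := hram
  set i := (unitsE L ⊓ (⊤ : Subgroup Lˣ).map (Herbrand.norm (L ≃ₐ[K] L))).relIndex (unitsE L ⊓ (unitsIncl K L).range) with hi
  -- `#Cl(L)^G · i · k = h_K`
  have hA : Nat.card {c : ClassGroup (𝓞 L) // ∀ τ : L ≃ₐ[K] L, ClassGroup.mulEquiv (intAut τ) c = c} * i * k =
      classNumber K := by
    have h4 : Nat.card {c : ClassGroup (𝓞 L) // ∀ τ : L ≃ₐ[K] L, ClassGroup.mulEquiv (intAut τ) c = c} * i * k * 2 =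
        classNumber K * 2 := by
      calc _ = Nat.card {c : ClassGroup (𝓞 L) // ∀ τ : L ≃ₐ[K] L, ClassGroup.mulEquiv (intAut τ) c = c} * 2 * i * k := by ring
        _ = classNumber K * (∏ᶠ v : HeightOneSpectrum (𝓞 K), v.asIdeal.ramificationIdxIn (𝓞 L)) * k := by rw [hChev]
        _ = classNumber K * 2 := by rw [mul_assoc, ← hk]
    exact Nat.eq_of_mul_eq_mul_right (by norm_num) h4
  have hAodd : Odd (Nat.card {c : ClassGroup (𝓞 L) // ∀ τ : L ≃ₐ[K] L, ClassGroup.mulEquiv (intAut τ) c = c}) := by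
    rw [← hA, mul_assoc] at hK
    exact (Nat.odd_mul.mp hK).1
  have hσ2 : σ ^ 2 ^ 1 = 1 := by
    have hc : Fintype.card (L ≃ₐ[K] L) = 2 := by
      rw [← Nat.card_eq_fintype_card, IsGalois.card_aut_eq_finrank, h2]
    rw [pow_one, ← hc]
    exact pow_card_eq_one
  exact odd_classNumber_of_odd_card_fixed hσ hσ2 hAodd

/-! ### Two independent non-norm units make the unit index divisible by `4` -/

/-- In a group, an element `g` with `g ^ 2 = 1` has `zpowers g = {1, g}`: every `h ∈ zpowers g` is `1` or `g`. [folklore] -/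
private theorem eq_one_or_eq_of_mem_zpowers_of_sq {G : Type*} [Group G] {g h : G} (hg : g ^ 2 = 1)
    (hh : h ∈ Subgroup.zpowers g) : h = 1 ∨ h = g := by
  obtain ⟨k, rfl⟩ := Subgroup.mem_zpowers_iff.mp hh
  have h2 : orderOf g ∣ 2 := orderOf_dvd_of_pow_eq_one hg
  have hk : g ^ k = g ^ (k % 2) := by
    rw [← zpow_mod_orderOf g k]
    rcases (Nat.dvd_prime Nat.prime_two).mp h2 with h1 | h1
    · rw [orderOf_eq_one_iff.mp h1]; simp
    · rw [h1]; rfl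
  rcases Int.emod_two_eq_zero_or_one k with h0 | h0
  · left; rw [hk, h0, zpow_zero]
  · right; rw [hk, h0, zpow_one]

/-- **In an abelian group, a subgroup `N` containing all squares and missing `x`, `y` and `x y` has index divisible by `4`**:
the class of `x` in `G/N` has order `2`, and the class of `y` is non-trivial modulo `⟨x̄⟩ = {1, x̄}` (it is neither `1` nor `x̄`, the latter
because `x y ∉ N` and `x̄² = 1`), so `#(G/N) = #⟨x̄⟩ · #((G/N)/⟨x̄⟩) = 2 · 2m`. [folklore] -/
private theorem four_dvd_index_of_sq_mem {G : Type*} [CommGroup G] {N : Subgroup G} (hsq : ∀ g : G, g ^ 2 ∈ N)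
    {x y : G} (hx : x ∉ N) (hy : y ∉ N) (hxy : x * y ∉ N) : 4 ∣ N.index := by
  classical
  rw [Subgroup.index]
  set qx : G ⧸ N := QuotientGroup.mk x with hqx
  set qy : G ⧸ N := QuotientGroup.mk y with hqy
  have hqx1 : qx ≠ 1 := fun h => hx ((QuotientGroup.eq_one_iff x).mp h)
  have hqy1 : qy ≠ 1 := fun h => hy ((QuotientGroup.eq_one_iff y).mp h)
  have hqxy1 : qx * qy ≠ 1 := fun h => hxy ((QuotientGroup.eq_one_iff (x * y)).mp (by rw [QuotientGroup.mk_mul]; exact h))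
  have hqx2 : qx ^ 2 = 1 := by rw [hqx, ← QuotientGroup.mk_pow, QuotientGroup.eq_one_iff]; exact hsq x
  have hqy2 : qy ^ 2 = 1 := by rw [hqy, ← QuotientGroup.mk_pow, QuotientGroup.eq_one_iff]; exact hsq y
  have hordx : orderOf qx = 2 := orderOf_eq_prime hqx2 hqx1
  have hcardx : Nat.card (Subgroup.zpowers qx) = 2 := by rw [Nat.card_zpowers, hordx]
  set Z := Subgroup.zpowers qx with hZ
  set ry : (G ⧸ N) ⧸ Z := QuotientGroup.mk qy with hry
  have hry1 : ry ≠ 1 := by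
    intro h
    rw [hry, QuotientGroup.eq_one_iff] at h
    rcases eq_one_or_eq_of_mem_zpowers_of_sq hqx2 h with h1 | h1
    · exact hqy1 h1
    · apply hqxy1
      rw [← h1, ← pow_two, hqy2]
  have hry2 : ry ^ 2 = 1 := by rw [hry, ← QuotientGroup.mk_pow, hqy2, QuotientGroup.mk_one]
  have hordy : orderOf ry = 2 := orderOf_eq_prime hry2 hry1
  obtain ⟨m, hm⟩ : 2 ∣ Nat.card ((G ⧸ N) ⧸ Z) := by rw [← hordy]; exact orderOf_dvd_natCard ry
  rw [Subgroup.card_eq_card_quotient_mul_card_subgroup Z, hm, hcardx]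
  exact ⟨m, by ring⟩

/-- **The unit index of Chevalley's formula is divisible by `4` as soon as TWO units `x, y ∈ E_K` have `x`, `y`, `x·y` all outside
`N_{L/K} Lˣ`** (`[L : K] = 2`).  In `Q = E_K / (E_K ∩ N)` every class has order `≤ 2` (`z² = N_{L/K}(z)` is a norm, tree
`pow_finrank_mem_map_norm`), and `four_dvd_index_of_sq_mem` applies.
[cite: Lang1990, Ch. 13 §4, Lemma 4.1 and proof of Lemma 4.2 (PDF pp. 203–204)] [cite: Gras2003, IV.4 (genus theory)] -/
theorem four_dvd_relIndex_unitsNorm_of_not_mem [IsGalois K L] (h2 : Module.finrank K L = 2) {x y : Lˣ}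
    (hxE : x ∈ unitsE L ⊓ (unitsIncl K L).range) (hyE : y ∈ unitsE L ⊓ (unitsIncl K L).range)
    (hxN : x ∉ (⊤ : Subgroup Lˣ).map (Herbrand.norm (L ≃ₐ[K] L)))
    (hyN : y ∉ (⊤ : Subgroup Lˣ).map (Herbrand.norm (L ≃ₐ[K] L)))
    (hxyN : x * y ∉ (⊤ : Subgroup Lˣ).map (Herbrand.norm (L ≃ₐ[K] L))) :
    4 ∣ (unitsE L ⊓ (⊤ : Subgroup Lˣ).map (Herbrand.norm (L ≃ₐ[K] L))).relIndex
        (unitsE L ⊓ (unitsIncl K L).range) := by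
  classical
  set N := (⊤ : Subgroup Lˣ).map (Herbrand.norm (L ≃ₐ[K] L)) with hN
  set H := unitsE L ⊓ N with hH
  set E := unitsE L ⊓ (unitsIncl K L).range with hE
  rw [Subgroup.relIndex]
  -- squares of elements of `E` are norms
  have hsq : ∀ g : E, g ^ 2 ∈ H.subgroupOf E := by
    intro g
    rw [Subgroup.mem_subgroupOf, Subgroup.coe_pow]
    refine ⟨(unitsE L).pow_mem g.2.1 2, ?_⟩
    have h := pow_finrank_mem_map_norm (K := K) (L := L) g.2.2
    rw [h2] at h
    exact h
  have hmem : ∀ {z : Lˣ} (hz : z ∈ E), (⟨z, hz⟩ : E) ∈ H.subgroupOf E ↔ z ∈ N := by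
    intro z hz
    rw [Subgroup.mem_subgroupOf]
    exact ⟨fun h => h.2, fun h => ⟨hz.1, h⟩⟩
  have hxyE : x * y ∈ E := E.mul_mem hxE hyE
  refine four_dvd_index_of_sq_mem hsq (x := ⟨x, hxE⟩) (y := ⟨y, hyE⟩) (fun h => hxN ((hmem hxE).mp h))
    (fun h => hyN ((hmem hyE).mp h)) (fun h => hxyN ((hmem hxyE).mp ?_))
  exact h

/-! ### Three ramified primes: two independent non-norm units -/

/-- **Odd class numbers go up a totally real quadratic extension with at most THREE ramified finite primes and TWO independent
non-norm units.**  `L/K` quadratic Galois, `L` totally real, `∏_𝔭 e_𝔭(L/K) ∣ 8`, `h_K` odd, and `x, y ∈ E_K` with `x, y, xy ∉ N_{L/K} Lˣ`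
⟹ `h_L` odd.  Chevalley: `#Cl(L)^G · 2 · 4m = h_K · ∏ e_𝔭` and `∏ e_𝔭 · k = 8`, so `#Cl(L)^G · m · k = h_K` is odd.
[cite: Lang1990, Ch. 13 §4, Lemma 4.1 (PDF pp. 203–204)] [cite: Gras2003, IV.4 (genus theory)] -/
theorem odd_classNumber_of_quadratic_of_isTotallyReal_of_not_mem_norm₂ [IsGalois K L] [IsTotallyReal L]
    (h2 : Module.finrank K L = 2) (hram : (∏ᶠ v : HeightOneSpectrum (𝓞 K), v.asIdeal.ramificationIdxIn (𝓞 L)) ∣ 8)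
    {x y : Lˣ} (hxE : x ∈ unitsE L ⊓ (unitsIncl K L).range) (hyE : y ∈ unitsE L ⊓ (unitsIncl K L).range)
    (hxN : x ∉ (⊤ : Subgroup Lˣ).map (Herbrand.norm (L ≃ₐ[K] L)))
    (hyN : y ∉ (⊤ : Subgroup Lˣ).map (Herbrand.norm (L ≃ₐ[K] L)))
    (hxyN : x * y ∉ (⊤ : Subgroup Lˣ).map (Herbrand.norm (L ≃ₐ[K] L)))
    (hK : Odd (classNumber K)) : Odd (classNumber L) := by
  classical
  obtain ⟨σ, -, -, hσ⟩ := exists_algEquiv_ne_one_of_finrank_eq_two (K := K) (L := L) h2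
  have hChev := ambiguousClassNumberFormula hσ
  rw [h2, archFactor_eq_one_of_isTotallyReal, mul_one] at hChev
  obtain ⟨m, hm⟩ := four_dvd_relIndex_unitsNorm_of_not_mem h2 hxE hyE hxN hyN hxyN
  obtain ⟨k, hk⟩ := hram
  rw [hm] at hChev
  have hA : Nat.card {c : ClassGroup (𝓞 L) // ∀ τ : L ≃ₐ[K] L, ClassGroup.mulEquiv (intAut τ) c = c} * m * k =
      classNumber K := by
    have h8 : Nat.card {c : ClassGroup (𝓞 L) // ∀ τ : L ≃ₐ[K] L, ClassGroup.mulEquiv (intAut τ) c = c} * m * k * 8 =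
        classNumber K * 8 := by
      calc _ = Nat.card {c : ClassGroup (𝓞 L) // ∀ τ : L ≃ₐ[K] L, ClassGroup.mulEquiv (intAut τ) c = c} * 2 * (4 * m) * k := by ring
        _ = classNumber K * (∏ᶠ v : HeightOneSpectrum (𝓞 K), v.asIdeal.ramificationIdxIn (𝓞 L)) * k := by rw [hChev]
        _ = classNumber K * 8 := by rw [mul_assoc, ← hk]
    exact Nat.eq_of_mul_eq_mul_right (by norm_num) h8
  have hAodd : Odd (Nat.card {c : ClassGroup (𝓞 L) // ∀ τ : L ≃ₐ[K] L, ClassGroup.mulEquiv (intAut τ) c = c}) := by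
    rw [← hA, mul_assoc] at hK
    exact (Nat.odd_mul.mp hK).1
  have hσ2 : σ ^ 2 ^ 1 = 1 := by
    have hc : Fintype.card (L ≃ₐ[K] L) = 2 := by
      rw [← Nat.card_eq_fintype_card, IsGalois.card_aut_eq_finrank, h2]
    rw [pow_one, ← hc]
    exact pow_card_eq_one
  exact odd_classNumber_of_odd_card_fixed hσ hσ2 hAodd

/-- **The same with the two units given as units of `𝓞 K` and the non-norm properties in norm-form currency**: `L = K(s)` totally
real, `s² = m ∈ K`, `s ∉ K`, `[L : K] = 2`, `∏_𝔭 e_𝔭(L/K) ∣ 8`, `h_K` odd, and units `ε₁, ε₂` of `𝓞 K` with `a² − m b² ∉ {ε₁, ε₂, ε₁ε₂}` for all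
`a, b ∈ K` ⟹ `h_L` odd. [cite: Lang1990, Ch. 13 §4, Lemma 4.1 (PDF pp. 203–204)] [cite: Omeara1963, §63B (63:10)] [cite: Gras2003, IV.4] -/
theorem odd_classNumber_of_quadratic_of_isTotallyReal_of_forall_sq_sub_mul_sq_ne₂ [IsGalois K L] [IsTotallyReal L]
    (h2 : Module.finrank K L = 2) (hram : (∏ᶠ v : HeightOneSpectrum (𝓞 K), v.asIdeal.ramificationIdxIn (𝓞 L)) ∣ 8)
    {s : L} {m : K} (hs : s ^ 2 = algebraMap K L m) (hsK : s ∉ Set.range (algebraMap K L))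
    (ε₁ ε₂ : (𝓞 K)ˣ) (hne₁ : ∀ a b : K, a ^ 2 - m * b ^ 2 ≠ ((ε₁ : 𝓞 K) : K))
    (hne₂ : ∀ a b : K, a ^ 2 - m * b ^ 2 ≠ ((ε₂ : 𝓞 K) : K))
    (hne₁₂ : ∀ a b : K, a ^ 2 - m * b ^ 2 ≠ ((ε₁ : 𝓞 K) : K) * ((ε₂ : 𝓞 K) : K)) (hK : Odd (classNumber K)) :
    Odd (classNumber L) := by
  set u₁ : Kˣ := Units.map (algebraMap (𝓞 K) K : 𝓞 K →* K) ε₁ with hu₁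
  set u₂ : Kˣ := Units.map (algebraMap (𝓞 K) K : 𝓞 K →* K) ε₂ with hu₂
  have hu₁val : (u₁ : K) = ((ε₁ : 𝓞 K) : K) := rfl
  have hu₂val : (u₂ : K) = ((ε₂ : 𝓞 K) : K) := rfl
  have hmemE : ∀ (ε : (𝓞 K)ˣ), unitsIncl K L (Units.map (algebraMap (𝓞 K) K : 𝓞 K →* K) ε) ∈ unitsE L ⊓ (unitsIncl K L).range := by
    intro ε
    refine ⟨mem_unitsE_iff.mpr ⟨Units.map (algebraMap (𝓞 K) (𝓞 L) : 𝓞 K →* 𝓞 L) ε, Units.ext ?_⟩, ⟨_, rfl⟩⟩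
    simp only [Units.coe_map, MonoidHom.coe_coe]
    exact (IsScalarTower.algebraMap_apply (𝓞 K) (𝓞 L) L _).symm.trans (IsScalarTower.algebraMap_apply (𝓞 K) K L _)
  have hx := not_mem_map_norm_of_forall_sq_sub_mul_sq_ne h2 hs hsK u₁ (by rw [hu₁val]; exact hne₁)
  have hy := not_mem_map_norm_of_forall_sq_sub_mul_sq_ne h2 hs hsK u₂ (by rw [hu₂val]; exact hne₂)
  have hxy := not_mem_map_norm_of_forall_sq_sub_mul_sq_ne h2 hs hsK (u₁ * u₂)
    (by rw [Units.val_mul, hu₁val, hu₂val]; exact hne₁₂)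
  rw [map_mul] at hxy
  exact odd_classNumber_of_quadratic_of_isTotallyReal_of_not_mem_norm₂ h2 hram (hmemE ε₁) (hmemE ε₂) hx hy hxy hK

/-! ### The norm form `N_{L/K}(a + b s) = a² − m b²` -/

/-- **`N_{L/K}(a + b s) = a² − m b²`** for `L = K(s)` quadratic Galois, `s² = m`, `s ∉ K`, `a, b ∈ K`: the non-trivial automorphism
sends `s ↦ −s`, and the norm is the product over the two automorphisms. (Used to compute absolute norms of explicit elements of `L`
through `N_{L/ℚ} = N_{K/ℚ} ∘ N_{L/K}`.) [cite: Omeara1963, §63B (63:10)] [cite: Lang1990, Ch. 13 §4 (PDF p. 203)] -/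
theorem norm_algebraMap_add_mul_eq [IsGalois K L] (h2 : Module.finrank K L = 2) {s : L} {m : K}
    (hs : s ^ 2 = algebraMap K L m) (hsK : s ∉ Set.range (algebraMap K L)) (a b : K) :
    Algebra.norm K (algebraMap K L a + algebraMap K L b * s) = a ^ 2 - m * b ^ 2 := by
  classical
  obtain ⟨σ, hσ1, hall, -⟩ := exists_algEquiv_ne_one_of_finrank_eq_two (K := K) (L := L) h2
  have hfix : ∀ z : L, σ z = z → z ∈ Set.range (algebraMap K L) := by
    intro z hz
    refine (IsGalois.mem_range_algebraMap_iff_fixed z).mpr fun f => ?_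
    rcases hall f with rfl | rfl
    · rfl
    · exact hz
  have hσs : σ s = -s := by
    have hsq : (σ s) ^ 2 = s ^ 2 := by rw [← map_pow, hs, AlgEquiv.commutes]
    rcases sq_eq_sq_iff_eq_or_eq_neg.mp hsq with h | h
    · exact absurd (hfix s h) hsK
    · exact h
  apply (algebraMap K L).injective
  rw [Algebra.norm_eq_prod_automorphisms]
  have huniv : (Finset.univ : Finset (L ≃ₐ[K] L)) = {1, σ} := by
    ext f
    simp only [Finset.mem_univ, Finset.mem_insert, Finset.mem_singleton, true_iff]
    exact hall f
  rw [huniv, Finset.prod_pair hσ1.symm, AlgEquiv.one_apply, map_add, map_mul, AlgEquiv.commutes, AlgEquiv.commutes, hσs,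
    map_sub, map_mul, map_pow, map_pow, ← hs]
  ring

end Literature.NumberTheory.NumberFields.AmbiguousClass

end
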